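import Literature.MathematicalPhysics.QuantumManyBody.TorusFockLayer
import Mathlib.MeasureTheory.Function.Floor

/-!
# Bessel bound for the block modes (route `BlockLatticeFSum`; decomp-a2c lens-6 g22)

For the `K³` block indicator modes `u_B` (side `L/K`) of the cell `[0,L)³` and any continuous
`(n+1)`-particle `Ψ`: `Σ_B n(u_B) ≤ (n+1)·∫_(cell^(n+1)) |Ψ|²`; for a periodic trial state `Σ_B n(u_B) ≤ N`
(Cauchy–Schwarz block by block in the first particle, disjointness of the blocks, Tonelli).
Imports only `TorusFockLayer` (+ Mathlib floor measurability). No definitions, no `sorry`.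
-/

namespace Summit.AtomisticToContinuum.BoseEinsteinCondensation.Theses.BlockLatticeFSum.Bessel

open MeasureTheory Complex
open scoped ENNReal NNReal ComplexConjugate BigOperators
open Literature.MathematicalPhysics.QuantumManyBody.BoseGas

variable {L : ℝ} {n K : ℕ}

/-- Block membership in coordinates: `⌊K x_j/L⌋ = B_j ↔ (L/K)B_j ≤ x_j < (L/K)B_j + L/K`. -/
theorem block_iff_bounds (hK : 0 < K) (hL : 0 < L) (B : Fin 3 → Fin K) (x : Space) :
    (∀ j : Fin 3, ⌊(K : ℝ) * x j / L⌋ = (((B j : Fin K) : ℕ) : ℤ))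
      ↔ ∀ j : Fin 3, L / (K : ℝ) * (((B j : Fin K) : ℕ) : ℝ) ≤ x j
          ∧ x j < L / (K : ℝ) * (((B j : Fin K) : ℕ) : ℝ) + L / (K : ℝ) := by
  have hKr : (0 : ℝ) < (K : ℝ) := by exact_mod_cast hK
  have hl : (0 : ℝ) < L / (K : ℝ) := by positivity
  refine forall_congr' fun j => ?_
  have hq : (K : ℝ) * x j / L = x j / (L / (K : ℝ)) := by
    field_simp
  rw [hq, Int.floor_eq_iff, Int.cast_natCast, le_div_iff₀ hl, div_lt_iff₀ hl]
  constructor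
  · rintro ⟨h1, h2⟩; constructor <;> linarith
  · rintro ⟨h1, h2⟩; constructor <;> linarith

/-- The block is a translate of the small cell `[0,L/K)³`. -/
theorem block_eq_preimage (hK : 0 < K) (hL : 0 < L) (B : Fin 3 → Fin K) :
    {x : EuclideanSpace ℝ (Fin 3) | ∀ j : Fin 3, ⌊(K : ℝ) * x j / L⌋ = (((B j : Fin K) : ℕ) : ℤ)} = (fun x : Space => x + -(WithLp.toLp 2 (fun j : Fin 3 => L / (K : ℝ) * (((B j : Fin K) : ℕ) : ℝ)) : EuclideanSpace ℝ (Fin 3))) ⁻¹' cell (L / (K : ℝ)) := by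
  ext x
  rw [Set.mem_setOf_eq, block_iff_bounds hK hL B x, Set.mem_preimage]
  simp only [cell, Set.mem_setOf_eq, Set.mem_Ico, PiLp.add_apply, PiLp.neg_apply]
  refine forall_congr' fun j => ?_
  constructor
  · rintro ⟨h1, h2⟩; constructor <;> linarith
  · rintro ⟨h1, h2⟩; constructor <;> linarith

/-- Blocks are measurable. -/
theorem measurableSet_block (hK : 0 < K) (hL : 0 < L) (B : Fin 3 → Fin K) :
    MeasurableSet {x : EuclideanSpace ℝ (Fin 3) | ∀ j : Fin 3, ⌊(K : ℝ) * x j / L⌋ = (((B j : Fin K) : ℕ) : ℤ)} := by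
  rw [block_eq_preimage hK hL B]
  exact measurableSet_cell _ |>.preimage (measurable_id.add_const _)

/-- Volume of a block. -/
theorem volume_block (hK : 0 < K) (hL : 0 < L) (B : Fin 3 → Fin K) :
    volume {x : EuclideanSpace ℝ (Fin 3) | ∀ j : Fin 3, ⌊(K : ℝ) * x j / L⌋ = (((B j : Fin K) : ℕ) : ℤ)} = ENNReal.ofReal (L / (K : ℝ)) ^ 3 := by
  rw [block_eq_preimage hK hL B, measure_preimage_add_right, volume_cell]

/-- Blocks lie in the cell. -/
theorem block_subset_cell (hK : 0 < K) (hL : 0 < L) (B : Fin 3 → Fin K) :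
    {x : EuclideanSpace ℝ (Fin 3) | ∀ j : Fin 3, ⌊(K : ℝ) * x j / L⌋ = (((B j : Fin K) : ℕ) : ℤ)} ⊆ cell L := by
  intro x hx
  rw [Set.mem_setOf_eq, block_iff_bounds hK hL B x] at hx
  have hKr : (0 : ℝ) < (K : ℝ) := by exact_mod_cast hK
  have hl : (0 : ℝ) < L / (K : ℝ) := by positivity
  intro j
  obtain ⟨h1, h2⟩ := hx j
  have h0 : (0 : ℝ) ≤ (((B j : Fin K) : ℕ) : ℝ) := Nat.cast_nonneg _
  have hB : (((B j : Fin K) : ℕ) : ℝ) + 1 ≤ (K : ℝ) := by exact_mod_cast (B j).isLt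
  refine ⟨le_trans (mul_nonneg hl.le h0) h1, lt_of_lt_of_le h2 ?_⟩
  calc L / (K : ℝ) * (((B j : Fin K) : ℕ) : ℝ) + L / (K : ℝ)
      = L / (K : ℝ) * ((((B j : Fin K) : ℕ) : ℝ) + 1) := by ring
    _ ≤ L / (K : ℝ) * (K : ℝ) := mul_le_mul_of_nonneg_left hB hl.le
    _ = L := div_mul_cancel₀ _ hKr.ne'

/-- Distinct blocks are disjoint. -/
theorem disjoint_block_of_ne {B B' : Fin 3 → Fin K} (h : B ≠ B') :
    Disjoint {x : EuclideanSpace ℝ (Fin 3) | ∀ j : Fin 3, ⌊(K : ℝ) * x j / L⌋ = (((B j : Fin K) : ℕ) : ℤ)} {x : EuclideanSpace ℝ (Fin 3) | ∀ j : Fin 3, ⌊(K : ℝ) * x j / L⌋ = (((B' j : Fin K) : ℕ) : ℤ)} := by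
  rw [Set.disjoint_left]
  intro x hx hx'
  apply h
  funext j
  have h1 : ⌊(K : ℝ) * x j / L⌋ = (((B j : Fin K) : ℕ) : ℤ) := hx j
  have h2 : ⌊(K : ℝ) * x j / L⌋ = (((B' j : Fin K) : ℕ) : ℤ) := hx' j
  rw [h1] at h2
  exact Fin.ext (by exact_mod_cast h2)

/-- The block mode is the (normalised) indicator of its block. -/
theorem blockMode_eq_indicator (B : Fin 3 → Fin K) :
    (fun x : EuclideanSpace ℝ (Fin 3) => if (∀ j : Fin 3, ⌊(K : ℝ) * x j / L⌋ = (((B j : Fin K) : ℕ) : ℤ)) then ((((Real.sqrt ((L / (K : ℝ)) ^ 3))⁻¹ : ℝ) : ℂ)) else 0)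
      = Set.indicator {x : EuclideanSpace ℝ (Fin 3) | ∀ j : Fin 3, ⌊(K : ℝ) * x j / L⌋ = (((B j : Fin K) : ℕ) : ℤ)}
          (fun _ => ((((Real.sqrt ((L / (K : ℝ)) ^ 3))⁻¹ : ℝ) : ℂ))) := by
  funext x
  simp only [Set.indicator, Set.mem_setOf_eq]

/-- Amplitude of a block mode as a block integral of the first particle. -/
theorem modeAn_blockMode_eq (hK : 0 < K) (hL : 0 < L) (B : Fin 3 → Fin K)
    (Ψ : Config (n + 1) → ℂ) (Y : Config n) :
    modeAn L (fun x : EuclideanSpace ℝ (Fin 3) => if (∀ j : Fin 3, ⌊(K : ℝ) * x j / L⌋ = (((B j : Fin K) : ℕ) : ℤ)) then ((((Real.sqrt ((L / (K : ℝ)) ^ 3))⁻¹ : ℝ) : ℂ)) else 0) Ψ Y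
      = ((Real.sqrt (n + 1) : ℝ) : ℂ) * (((((Real.sqrt ((L / (K : ℝ)) ^ 3))⁻¹ : ℝ) : ℂ))
          * ∫ x in {x : EuclideanSpace ℝ (Fin 3) | ∀ j : Fin 3, ⌊(K : ℝ) * x j / L⌋ = (((B j : Fin K) : ℕ) : ℤ)}, Ψ (Matrix.vecCons x Y)) := by
  unfold modeAn
  congr 1
  rw [blockMode_eq_indicator B]
  have hint : ∀ x : Space, conj (Set.indicator {x : EuclideanSpace ℝ (Fin 3) | ∀ j : Fin 3, ⌊(K : ℝ) * x j / L⌋ = (((B j : Fin K) : ℕ) : ℤ)}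
      (fun _ => ((((Real.sqrt ((L / (K : ℝ)) ^ 3))⁻¹ : ℝ) : ℂ))) x) * Ψ (Matrix.vecCons x Y)
      = Set.indicator {x : EuclideanSpace ℝ (Fin 3) | ∀ j : Fin 3, ⌊(K : ℝ) * x j / L⌋ = (((B j : Fin K) : ℕ) : ℤ)}
          (fun x => ((((Real.sqrt ((L / (K : ℝ)) ^ 3))⁻¹ : ℝ) : ℂ)) * Ψ (Matrix.vecCons x Y)) x := by
    intro x
    by_cases hx : x ∈ {x : EuclideanSpace ℝ (Fin 3) | ∀ j : Fin 3, ⌊(K : ℝ) * x j / L⌋ = (((B j : Fin K) : ℕ) : ℤ)}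
    · rw [Set.indicator_of_mem hx, Set.indicator_of_mem hx, Complex.conj_ofReal]
    · rw [Set.indicator_of_notMem hx, Set.indicator_of_notMem hx, map_zero, zero_mul]
  simp_rw [hint]
  rw [setIntegral_indicator (measurableSet_block hK hL B),
    Set.inter_eq_right.2 (block_subset_cell hK hL B), integral_const_mul]

/-- Measurability of the block amplitude in `Y` for continuous `Ψ`. -/
theorem measurable_modeAn_blockMode (hK : 0 < K) (hL : 0 < L) (B : Fin 3 → Fin K)
    {Ψ : Config (n + 1) → ℂ} (hΨ : Continuous Ψ) :
    Measurable fun Y : Config n => modeAn L (fun x : EuclideanSpace ℝ (Fin 3) => if (∀ j : Fin 3, ⌊(K : ℝ) * x j / L⌋ = (((B j : Fin K) : ℕ) : ℤ)) then ((((Real.sqrt ((L / (K : ℝ)) ^ 3))⁻¹ : ℝ) : ℂ)) else 0) Ψ Y := by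
  have h : StronglyMeasurable (Function.uncurry fun (Y : Config n) (x : Space) =>
      Ψ (Matrix.vecCons x Y)) := by
    refine Measurable.stronglyMeasurable (hΨ.measurable.comp ?_)
    exact (continuous_snd.matrixVecCons continuous_fst).measurable
  have h2 : StronglyMeasurable fun Y : Config n =>
      ∫ x in {x : EuclideanSpace ℝ (Fin 3) | ∀ j : Fin 3, ⌊(K : ℝ) * x j / L⌋ = (((B j : Fin K) : ℕ) : ℤ)}, Ψ (Matrix.vecCons x Y) :=
    h.integral_prod_right' (ν := volume.restrict {x : EuclideanSpace ℝ (Fin 3) | ∀ j : Fin 3, ⌊(K : ℝ) * x j / L⌋ = (((B j : Fin K) : ℕ) : ℤ)})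
  simp_rw [modeAn_blockMode_eq hK hL B Ψ]
  exact measurable_const.mul (measurable_const.mul h2.measurable)

/-- **Pointwise Bessel** in the first particle: `Σ_B |a(u_B)Ψ(Y)|² ≤ (n+1)·∫_cell |Ψ(x,Y)|² dx`. -/
theorem sum_nnnorm_modeAn_blockMode_sq_le (hK : 0 < K) (hL : 0 < L)
    {Ψ : Config (n + 1) → ℂ} (hΨ : Continuous Ψ) (Y : Config n) :
    ∑ B : Fin 3 → Fin K, (‖modeAn L (fun x : EuclideanSpace ℝ (Fin 3) => if (∀ j : Fin 3, ⌊(K : ℝ) * x j / L⌋ = (((B j : Fin K) : ℕ) : ℤ)) then ((((Real.sqrt ((L / (K : ℝ)) ^ 3))⁻¹ : ℝ) : ℂ)) else 0) Ψ Y‖₊ : ℝ≥0∞) ^ 2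
      ≤ (n + 1 : ℝ≥0∞) * ∫⁻ x in cell L, (‖Ψ (Matrix.vecCons x Y)‖₊ : ℝ≥0∞) ^ 2 := by
  classical
  have hKr : (0 : ℝ) < (K : ℝ) := by exact_mod_cast hK
  have hs : (0 : ℝ) < L / (K : ℝ) := by positivity
  have hmeasY : Measurable fun x : Space => Ψ (Matrix.vecCons x Y) :=
    (continuous_vecCons_slice hΨ Y).measurable
  -- Cauchy–Schwarz against the constant function: `‖∫ f dμ‖² ≤ μ(univ) ∫ ‖f‖² dμ` (the tree's
  -- `BoseGas.nnnorm_integral_sq_le_mul_lintegral` lives in a module that does not build on the farm at present)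
  have nnnorm_integral_sq_le : ∀ (μ : Measure Space) {f : Space → ℂ}, AEMeasurable f μ →
      (‖∫ x, f x ∂μ‖₊ : ℝ≥0∞) ^ 2 ≤ μ Set.univ * ∫⁻ x, (‖f x‖₊ : ℝ≥0∞) ^ 2 ∂μ := by
    intro μ f hf
    have hmeas : AEMeasurable (fun x => (‖f x‖₊ : ℝ≥0∞)) μ := hf.nnnorm.coe_nnreal_ennreal
    have h := ENNReal.lintegral_mul_le_Lp_mul_Lq μ Real.HolderConjugate.two_two hmeas
      (g := fun _ => 1) aemeasurable_const
    simp only [Pi.mul_apply, mul_one, lintegral_const, ENNReal.rpow_two, one_pow, one_mul] at h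
    calc (‖∫ x, f x ∂μ‖₊ : ℝ≥0∞) ^ 2 ≤ (∫⁻ x, (‖f x‖₊ : ℝ≥0∞) ∂μ) ^ 2 := by
          gcongr; exact enorm_integral_le_lintegral_enorm _
      _ ≤ ((∫⁻ x, (‖f x‖₊ : ℝ≥0∞) ^ 2 ∂μ) ^ (1 / 2 : ℝ) * μ Set.univ ^ (1 / 2 : ℝ)) ^ 2 := by gcongr
      _ = μ Set.univ * ∫⁻ x, (‖f x‖₊ : ℝ≥0∞) ^ 2 ∂μ := by
          rw [← ENNReal.mul_rpow_of_nonneg _ _ (by norm_num : (0 : ℝ) ≤ 1 / 2), ← ENNReal.rpow_two,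
            ← ENNReal.rpow_mul]
          norm_num [mul_comm]
  have hc2 : ((‖((((Real.sqrt ((L / (K : ℝ)) ^ 3))⁻¹ : ℝ) : ℂ))‖₊ : ℝ≥0∞) ^ 2)
      = (ENNReal.ofReal (L / (K : ℝ)) ^ 3)⁻¹ := by
    rw [Complex.ofReal_inv]
    exact nnnorm_constantMode_sq hs
  have hv0 : ENNReal.ofReal (L / (K : ℝ)) ^ 3 ≠ 0 := pow_ne_zero _ (by simpa using hs)
  have hvT : ENNReal.ofReal (L / (K : ℝ)) ^ 3 ≠ ⊤ := ENNReal.pow_ne_top ENNReal.ofReal_ne_top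
  have hcell : ∀ B : Fin 3 → Fin K, (‖modeAn L (fun x : EuclideanSpace ℝ (Fin 3) => if (∀ j : Fin 3, ⌊(K : ℝ) * x j / L⌋ = (((B j : Fin K) : ℕ) : ℤ)) then ((((Real.sqrt ((L / (K : ℝ)) ^ 3))⁻¹ : ℝ) : ℂ)) else 0) Ψ Y‖₊ : ℝ≥0∞) ^ 2
      ≤ (n + 1 : ℝ≥0∞) * ∫⁻ x in {x : EuclideanSpace ℝ (Fin 3) | ∀ j : Fin 3, ⌊(K : ℝ) * x j / L⌋ = (((B j : Fin K) : ℕ) : ℤ)}, (‖Ψ (Matrix.vecCons x Y)‖₊ : ℝ≥0∞) ^ 2 := by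
    intro B
    rw [modeAn_blockMode_eq hK hL B Ψ Y, nnnorm_sqrt_mul_sq, nnnorm_mul, ENNReal.coe_mul, mul_pow, hc2]
    gcongr
    calc (ENNReal.ofReal (L / (K : ℝ)) ^ 3)⁻¹ *
          ((‖∫ x in {x : EuclideanSpace ℝ (Fin 3) | ∀ j : Fin 3, ⌊(K : ℝ) * x j / L⌋ = (((B j : Fin K) : ℕ) : ℤ)}, Ψ (Matrix.vecCons x Y)‖₊ : ℝ≥0∞) ^ 2)
        ≤ (ENNReal.ofReal (L / (K : ℝ)) ^ 3)⁻¹ * (volume {x : EuclideanSpace ℝ (Fin 3) | ∀ j : Fin 3, ⌊(K : ℝ) * x j / L⌋ = (((B j : Fin K) : ℕ) : ℤ)} *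
            ∫⁻ x in {x : EuclideanSpace ℝ (Fin 3) | ∀ j : Fin 3, ⌊(K : ℝ) * x j / L⌋ = (((B j : Fin K) : ℕ) : ℤ)}, (‖Ψ (Matrix.vecCons x Y)‖₊ : ℝ≥0∞) ^ 2) := by
          gcongr
          simpa only [Measure.restrict_apply_univ] using
            nnnorm_integral_sq_le (volume.restrict {x : EuclideanSpace ℝ (Fin 3) | ∀ j : Fin 3, ⌊(K : ℝ) * x j / L⌋ = (((B j : Fin K) : ℕ) : ℤ)}) hmeasY.aemeasurable
      _ = ∫⁻ x in {x : EuclideanSpace ℝ (Fin 3) | ∀ j : Fin 3, ⌊(K : ℝ) * x j / L⌋ = (((B j : Fin K) : ℕ) : ℤ)}, (‖Ψ (Matrix.vecCons x Y)‖₊ : ℝ≥0∞) ^ 2 := by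
          rw [volume_block hK hL, ← mul_assoc, ENNReal.inv_mul_cancel hv0 hvT, one_mul]
  calc ∑ B : Fin 3 → Fin K, (‖modeAn L (fun x : EuclideanSpace ℝ (Fin 3) => if (∀ j : Fin 3, ⌊(K : ℝ) * x j / L⌋ = (((B j : Fin K) : ℕ) : ℤ)) then ((((Real.sqrt ((L / (K : ℝ)) ^ 3))⁻¹ : ℝ) : ℂ)) else 0) Ψ Y‖₊ : ℝ≥0∞) ^ 2
      ≤ ∑ B : Fin 3 → Fin K, (n + 1 : ℝ≥0∞) *
          ∫⁻ x in {x : EuclideanSpace ℝ (Fin 3) | ∀ j : Fin 3, ⌊(K : ℝ) * x j / L⌋ = (((B j : Fin K) : ℕ) : ℤ)}, (‖Ψ (Matrix.vecCons x Y)‖₊ : ℝ≥0∞) ^ 2 :=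
        Finset.sum_le_sum fun B _ => hcell B
    _ = (n + 1 : ℝ≥0∞) * ∫⁻ x in ⋃ B ∈ (Finset.univ : Finset (Fin 3 → Fin K)), {x : EuclideanSpace ℝ (Fin 3) | ∀ j : Fin 3, ⌊(K : ℝ) * x j / L⌋ = (((B j : Fin K) : ℕ) : ℤ)},
          (‖Ψ (Matrix.vecCons x Y)‖₊ : ℝ≥0∞) ^ 2 := by
        rw [← Finset.mul_sum, lintegral_biUnion_finset (fun B _ B' _ h => disjoint_block_of_ne h)
          (fun B _ => measurableSet_block hK hL B)]
    _ ≤ (n + 1 : ℝ≥0∞) * ∫⁻ x in cell L, (‖Ψ (Matrix.vecCons x Y)‖₊ : ℝ≥0∞) ^ 2 := by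
        gcongr
        intro x hx
        simp only [Set.mem_iUnion, Finset.mem_univ, exists_true_left] at hx
        obtain ⟨B, hB⟩ := hx
        exact block_subset_cell hK hL B hB

/-- **BESSEL for the block modes:** `Σ_B n(u_B) ≤ (n+1)·∫_(cell^(n+1)) |Ψ|²` (continuous `Ψ`). -/
theorem sum_cellOccupation_blockMode_le (hK : 0 < K) (hL : 0 < L)
    {Ψ : Config (n + 1) → ℂ} (hΨ : Continuous Ψ) :
    ∑ B : Fin 3 → Fin K, cellOccupation (n + 1) L (fun x : EuclideanSpace ℝ (Fin 3) => if (∀ j : Fin 3, ⌊(K : ℝ) * x j / L⌋ = (((B j : Fin K) : ℕ) : ℤ)) then ((((Real.sqrt ((L / (K : ℝ)) ^ 3))⁻¹ : ℝ) : ℂ)) else 0) Ψ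
      ≤ (n + 1 : ℝ≥0∞) * ∫⁻ X in cellN (n + 1) L, (‖Ψ X‖₊ : ℝ≥0∞) ^ 2 := by
  have hmeas : ∀ B : Fin 3 → Fin K, Measurable fun Y : Config n =>
      (‖modeAn L (fun x : EuclideanSpace ℝ (Fin 3) => if (∀ j : Fin 3, ⌊(K : ℝ) * x j / L⌋ = (((B j : Fin K) : ℕ) : ℤ)) then ((((Real.sqrt ((L / (K : ℝ)) ^ 3))⁻¹ : ℝ) : ℂ)) else 0) Ψ Y‖₊ : ℝ≥0∞) ^ 2 := fun B =>
    ((measurable_modeAn_blockMode hK hL B hΨ).nnnorm.coe_nnreal_ennreal).pow_const 2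
  have hG : Measurable fun X : Config (n + 1) => (‖Ψ X‖₊ : ℝ≥0∞) ^ 2 :=
    (hΨ.measurable.nnnorm.coe_nnreal_ennreal).pow_const 2
  simp_rw [cellOccupation_eq_lintegral_modeAn]
  rw [← lintegral_finsetSum _ fun B _ => hmeas B, Literature.MathematicalPhysics.QuantumManyBody.BoseGas.lintegral_cellN_succ L hG,
    ← lintegral_const_mul' _ _ (by simp)]
  exact lintegral_mono fun Y => sum_nnnorm_modeAn_blockMode_sq_le hK hL hΨ Y

/-- **BESSEL for a periodic trial state:** `Σ_B n(u_B) ≤ N`. -/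
theorem sum_cellOccupation_blockMode_le_card {N : ℕ} (hN : 0 < N) (hK : 0 < K) (hL : 0 < L)
    (Ψ : PeriodicTrialState N L) :
    ∑ B : Fin 3 → Fin K, cellOccupation N L (fun x : EuclideanSpace ℝ (Fin 3) => if (∀ j : Fin 3, ⌊(K : ℝ) * x j / L⌋ = (((B j : Fin K) : ℕ) : ℤ)) then ((((Real.sqrt ((L / (K : ℝ)) ^ 3))⁻¹ : ℝ) : ℂ)) else 0) Ψ.ψ ≤ (N : ℝ≥0∞) := by
  obtain ⟨n, rfl⟩ : ∃ n, N = n + 1 := ⟨N - 1, by omega⟩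
  have h := sum_cellOccupation_blockMode_le (L := L) (K := K) hK hL Ψ.contDiff.continuous
  rw [Ψ.norm_eq, mul_one] at h
  exact_mod_cast h

end Summit.AtomisticToContinuum.BoseEinsteinCondensation.Theses.BlockLatticeFSum.Bessel
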